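import Summits.HodgeConjecture.HodgeConjecture.Theorems.R90S3PlacesOverPlantedPrime        -- ★ P9′ (K2E3-p21): `ne_of_valued_apply_ne`, `exists_valued_apply_ne_of_apply_ne_rat` (+ ★ P1 by import)
import Summits.HodgeConjecture.HodgeConjecture.Theorems.R90S3UnitAwayFromPlantedPlace      -- ★ P5 (K2E3-p21): `not_mem_of_absNorm_eq_prime_pow_of_natCast_not_mem`, `absNorm_span_singleton_eq_of_abs_norm_eq`
import Summits.HodgeConjecture.HodgeConjecture.Theorems.R90S3KrasnerTransportToCompletion   -- ★ P2″ (K2E4-p14): `denseRange_of_adjoin_eq_top`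
import Summits.HodgeConjecture.HodgeConjecture.Theorems.R90S3LocalRingIsoNorm               -- ★ G1-a (K2E4-p14): `ArchProp42.norm_lt_one_iff` by import (bicontinuous isos preserve the unit ball)
import Literature.NumberTheory.NumberFields.CompletionLocalDegree                           -- ★ `finrank_padic_adicCompletion_eq'` (ANY continuous `ℚ_p`-structure: `[F_v : ℚ_p] = e′ f′`), `LocalField.*` rat-place lemmas
import Mathlib.NumberTheory.Padics.HeightOneSpectrum
import Mathlib.NumberTheory.RamificationInertia.Basic
import HarnessLib

/-!
# R90-TF · S3, (U3-F) assembly, layer B7: THE PLANTED PLACE `v′` AND THE UNIT CLAUSE `α ∉ 𝔭_u (u ≠ v′)`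
# (`Theorems/R90S3PlantedRootsAndPlaces.lean`; captain's skeleton `R90/S3/SKELETON-P8-AuxGlobaliseField.K2E3-p17-g11.md` 941dd0e5 §B7 (+ the over-`p`
# half of §B8∕B9); dealer R90-C12-plan (g2) 01:04:01Z ∕ 01:16:20Z «B6+B7 glue … B7 second»)

Cell `hodgecm-mathlib`, crux H413 (`stmt-HodgeConjecture-24833`), route of record `HCCMUnconditional`; programme R90-TF, section S3 (base `R90-C12`), the (U3-F)
residual `stub_R90_S3_auxGlobaliseField` (ℚ-planted road).  Lane `--supports stmt-HodgeConjecture-24833 --as helper`; THEOREMS ONLY (no `def`, no `instance`, no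
notation, no named fact, no `sorry`); ★∕Mathlib imports only; ns `…R90.S3`.

THE MATHEMATICS [Neukirch, *Algebraic Number Theory*, Ch. II (8.2)–(8.5); Cassels–Fröhlich Ch. II §10; Serre, *Local Fields*, Ch. II §3].  INPUT (from ★ B2,
★ B5+B8, ★ B6 and the captain's lift): `K = L_w` (`w ∣ p`, continuous finite `ℚ_p`-structure of degree `d₀`); a number field `F` with `α ∈ 𝓞 F`,
`[F : ℚ] = d₀ + r`, `|N_{F∕ℚ}(α)| = p^a`; ring homomorphisms `J₀ : F → K` with `J₀ α = β`, `ℚ_p⟮β⟯ = ⊤`, `v_w(β) < 1`, and `Jᵢ : F → ℚ_p` (`i < r`) with `Jᵢ α = c′ᵢ`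
DISTINCT UNITS.  OUTPUT (**`exists_plantedPlace`**): `J₀` has dense image (★ P2″ §3) and pins a finite place `v′` of `F` (★ P1: `x ∈ 𝔭_{v′} ⟺ v_w(J₀ x) < 1`) with
`p, α ∈ 𝔭_{v′}`, and **`α ∉ 𝔭_u` for every finite place `u ≠ v′`** — the `hαu` input of ★ P8c `isUnramifiedAt_of_planted(_cm)` for ALL `u`:
* `u ∤ p`: ★ P5 (`|N α| = p^a` ⇒ a prime containing `α` contains `p`);
* `u ∣ p`: the `Jᵢ`, read in the `(p)`-adic completion of `ℚ` through Mathlib's `Padic.adicCompletionEquiv`, are dense and pin places `Uᵢ ∣ p` (★ P1) with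
  `α ∉ 𝔭_{Uᵢ}` (`c′ᵢ` is a unit; a bicontinuous iso preserves `v < 1`, ★ `ArchProp42.norm_lt_one_iff`), pairwise distinct (★ P9′ `exists_valued_apply_ne_of_apply_ne_rat`,
  `ne_of_valued_apply_ne`) and distinct from `v′` (`α ∈ 𝔭_{v′}`); their LOCAL DEGREES are `e′f′(v′) = [F_{v′} : ℚ_p] = [K : ℚ_p] = d₀` and `e′f′(Uᵢ) = 1` — ★
  `CompletionLocalDegree.finrank_padic_adicCompletion_eq'` holds for ANY continuous `ℚ_p`-structure, so we may use the one TRANSPORTED along ★ P1's bicontinuous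
  `ψ : F_{v′} ≃+* K` (resp. `F_{Uᵢ} ≃+* ℚ_{(p)} ≃ ℚ_p`), along which `finrank` is invariant (Mathlib `Algebra.finrank_eq_of_equiv_equiv`) — no density or
  semilinearity argument; since `d₀ + r·1 = [F : ℚ] = Σ_{u ∣ p} e′(u) f′(u)` (Mathlib `Ideal.sum_ramification_inertia` over `ℤ`) and every term is positive,
  `{v′, U₁, …, U_r}` EXHAUSTS the places over `p` (**`forall_mem_of_sum_ramificationIdx_mul_inertiaDeg_eq_finrank_int`**), whence `α ∉ 𝔭_u` for `u ∣ p`, `u ≠ v′`.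
HONEST LABEL: B7 is a sub-brick of the GENUINE residual (U3-F) and closes nothing alone; HC_CM is proved only modulo the 7 printed citations (2 remaining named
inputs: hLiu418 = stmt-HodgeConjecture-24832, h413 = stmt-HodgeConjecture-24833) until rung 0 closes; count-neutral helper.

## References
* [NeukirchANT1999] J. Neukirch, *Algebraic Number Theory*, Grundlehren 322 (1999), Ch. II (8.2)–(8.5).
* [CasselsFrohlichANT1967] J. W. S. Cassels, A. Fröhlich (eds.), *Algebraic Number Theory* (1967), Ch. II §10 (10.2)–(10.3).
* [Serre1979] J.-P. Serre, *Local Fields*, GTM 67 (1979), Ch. II §3.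
-/

set_option autoImplicit false
-- the mandated namespace repeats the single-problem summit's segment (`HodgeConjecture.HodgeConjecture`)
set_option linter.dupNamespace false

noncomputable section

open Polynomial IntermediateField Topology Filter IsDedekindDomain NumberField Finset
open Literature.AnabelianGeometry.AbsoluteAnabelian (ArchProp42.norm_lt_one_iff)
open Literature.NumberTheory.NumberFields (finrank_padic_adicCompletion_eq')
open Literature.NumberTheory.GaloisRepresentations.LocalField (primesEquiv_eq_of_natCast_mem)

namespace Summit.HodgeConjecture.HodgeConjecture.R90.S3

variable (p : ℕ) [Fact p.Prime]

/-! ## §1 Service lemmas: valuations of `p`, the `(p)`-adic completion of `ℚ` vs `ℚ_p`, primes over `(p) ⊆ ℤ` -/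

omit [Fact p.Prime] in
/-- `v_w(p) < 1` in `L_w` when `p ∈ 𝔭_w`. [cite: NeukirchANT1999, Ch. II (8.2)] -/
theorem valued_natCast_lt_one_of_mem {L : Type} [Field L] [NumberField L] (w : HeightOneSpectrum (𝓞 L)) (hw : ((p : ℕ) : 𝓞 L) ∈ w.asIdeal) :
    Valued.v ((p : ℕ) : w.adicCompletion L) < 1 := by
  have h : ((p : ℕ) : w.adicCompletion L) = algebraMap (𝓞 L) (w.adicCompletion L) (p : 𝓞 L) := by rw [map_natCast]
  rw [h]
  exact (HeightOneSpectrum.valuedAdicCompletion_eq_valuation w ((p : ℕ) : 𝓞 L)).trans_lt ((HeightOneSpectrum.valuation_lt_one_iff_mem w _).2 hw)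

/-- **Reading `ℚ_p` in the `(p)`-adic completion of `ℚ`**: a continuous `ℚ`-algebra isomorphism `E : ℚ_p ≃ ℚ_{v₀}` (Mathlib `Padic.adicCompletionEquiv`) satisfies
`v(E x) < 1 ⟺ ‖x‖ < 1` — stated for any bicontinuous ring isomorphism (both say `xⁿ → 0`; ★ `ArchProp42.norm_lt_one_iff`). [cite: Serre1979, Ch. II §3] -/
theorem valued_ringEquiv_lt_one_iff (v₀ : HeightOneSpectrum (𝓞 ℚ)) (E : ℚ_[p] ≃+* v₀.adicCompletion ℚ) (hE : Continuous E) (hE' : Continuous E.symm)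
    (x : ℚ_[p]) : Valued.v (E x) < 1 ↔ ‖x‖ < 1 := by
  rw [← Valued.toNormedField.norm_lt_one_iff]
  exact ArchProp42.norm_lt_one_iff E hE hE' x

/-- The rational prime `p` lies in the place `primesEquiv⁻¹ p` of `ℚ`. [folklore] -/
theorem natCast_mem_primesEquiv_symm :
    ((p : ℕ) : 𝓞 ℚ) ∈ ((Rat.HeightOneSpectrum.primesEquiv (R := 𝓞 ℚ)).symm ⟨p, Fact.out⟩).asIdeal := by
  set v₀ := (Rat.HeightOneSpectrum.primesEquiv (R := 𝓞 ℚ)).symm ⟨p, Fact.out⟩ with hv₀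
  have h1 : Rat.HeightOneSpectrum.natGenerator v₀ = p :=
    congrArg Subtype.val ((Rat.HeightOneSpectrum.primesEquiv (R := 𝓞 ℚ)).apply_symm_apply ⟨p, Fact.out⟩)
  have h2 := (Rat.HeightOneSpectrum.natGenerator_dvd_iff v₀ (n := p)).1 (h1 ▸ dvd_rfl)
  rwa [← map_natCast (Rat.IsIntegralClosure.intEquiv (𝓞 ℚ)) p, Ideal.apply_mem_of_equiv_iff] at h2

/-- A prime of `𝓞 F` containing `p` lies over `(p) ⊆ ℤ`. [folklore] -/
theorem liesOver_span_of_natCast_mem {F : Type} [Field F] [NumberField F] (u : HeightOneSpectrum (𝓞 F)) (hu : ((p : ℕ) : 𝓞 F) ∈ u.asIdeal) :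
    u.asIdeal.LiesOver (Ideal.span {(p : ℤ)}) := by
  have hp : (p : ℤ) ≠ 0 := Int.natCast_ne_zero.mpr (Fact.out : p.Prime).ne_zero
  have hprime : (Ideal.span {(p : ℤ)}).IsPrime := (Ideal.span_singleton_prime hp).mpr (Nat.prime_iff_prime_int.mp Fact.out)
  have hmax : (Ideal.span {(p : ℤ)}).IsMaximal := hprime.isMaximal (by simpa using hp)
  refine ⟨hmax.eq_of_le (Ideal.comap_ne_top _ u.isMaximal.ne_top) ?_⟩
  rw [Ideal.span_le, Set.singleton_subset_iff]
  change algebraMap ℤ (𝓞 F) (p : ℤ) ∈ u.asIdeal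
  simpa using hu

/-- **EXHAUSTION OF THE PLACES OVER `p` BY `Σ e′ f′`** (over `ℤ`, Mathlib `Ideal.sum_ramification_inertia`): if finitely many places `u ∈ T` of `F`, all over `p`,
already have `Σ_{u ∈ T} e′(u|p) f′(u|p) = [F : ℚ]`, then every place of `F` over `p` belongs to `T` (all terms of the full sum are positive).
[cite: NeukirchANT1999, Ch. II (8.2)] [cite: CasselsFrohlichANT1967, Ch. II §10 (10.3)] -/
theorem forall_mem_of_sum_ramificationIdx_mul_inertiaDeg_eq_finrank_int {F : Type} [Field F] [NumberField F] (T : Finset (HeightOneSpectrum (𝓞 F)))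
    (hT : ∀ u ∈ T, ((p : ℕ) : 𝓞 F) ∈ u.asIdeal)
    (hsum : ∑ u ∈ T, Ideal.ramificationIdx' (Ideal.span {(p : ℤ)}) u.asIdeal * Ideal.inertiaDeg' (Ideal.span {(p : ℤ)}) u.asIdeal = Module.finrank ℚ F)
    (u : HeightOneSpectrum (𝓞 F)) (hu : ((p : ℕ) : 𝓞 F) ∈ u.asIdeal) : u ∈ T := by
  classical
  set P₀ : Ideal ℤ := Ideal.span {(p : ℤ)} with hP₀
  have hp : (p : ℤ) ≠ 0 := Int.natCast_ne_zero.mpr (Fact.out : p.Prime).ne_zero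
  have hP0 : P₀ ≠ ⊥ := by simpa [hP₀] using hp
  haveI : P₀.IsMaximal := ((Ideal.span_singleton_prime hp).mpr (Nat.prime_iff_prime_int.mp Fact.out)).isMaximal hP0
  -- the full sum over the primes over `(p)`
  have hall := Ideal.sum_ramification_inertia (R := ℤ) (𝓞 F) ℚ F hP0 (p := P₀)
  set g : Ideal (𝓞 F) → ℕ := fun P => Ideal.ramificationIdx' P₀ P * Ideal.inertiaDeg' P₀ P with hg
  set S := IsDedekindDomain.primesOverFinset P₀ (𝓞 F) with hS
  -- `T ↪ S` via `asIdeal`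
  have hmemS : ∀ u' : HeightOneSpectrum (𝓞 F), ((p : ℕ) : 𝓞 F) ∈ u'.asIdeal → u'.asIdeal ∈ S := fun u' hu' =>
    (IsDedekindDomain.mem_primesOverFinset_iff hP0 (𝓞 F)).2 ⟨u'.isPrime, liesOver_span_of_natCast_mem p u' hu'⟩
  set S' := T.image (fun u' : HeightOneSpectrum (𝓞 F) => u'.asIdeal) with hS'
  have hsub : S' ⊆ S := by
    intro P hP
    obtain ⟨u', hu'T, rfl⟩ := Finset.mem_image.1 hP
    exact hmemS u' (hT u' hu'T)
  have hinj : Set.InjOn (fun u' : HeightOneSpectrum (𝓞 F) => u'.asIdeal) (T : Set (HeightOneSpectrum (𝓞 F))) :=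
    fun a _ b _ h => HeightOneSpectrum.ext h
  have hS'sum : ∑ P ∈ S', g P = Module.finrank ℚ F := by
    rw [hS', Finset.sum_image hinj]
    exact hsum
  -- hence the terms outside `S'` sum to zero, and they are positive: `S ⊆ S'`
  have hdiff : ∑ P ∈ S \ S', g P = 0 := by
    have h := Finset.sum_sdiff hsub (f := g)
    rw [hS'sum, hall] at h
    omega
  have hSS' : ∀ P ∈ S, P ∈ S' := by
    intro P hP
    by_contra hPS'
    have hz := (Finset.sum_eq_zero_iff.1 hdiff) P (Finset.mem_sdiff.2 ⟨hP, hPS'⟩)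
    have hP' := (IsDedekindDomain.mem_primesOverFinset_iff hP0 (𝓞 F)).1 hP
    haveI : P.IsPrime := hP'.1
    haveI : P.LiesOver P₀ := hP'.2
    have h1 : Ideal.ramificationIdx' P₀ P ≠ 0 := Ideal.IsDedekindDomain.ramificationIdx'_ne_zero_of_liesOver P hP0
    have h2 : Ideal.inertiaDeg' P₀ P ≠ 0 := Ideal.inertiaDeg'_ne_zero P₀ P
    exact (mul_ne_zero h1 h2) hz
  -- read back `u`
  obtain ⟨u', hu'T, hu'⟩ := Finset.mem_image.1 (hSS' _ (hmemS u hu))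
  rwa [← HeightOneSpectrum.ext hu']

/-! ## §2 HEAD: the planted place and the unit clause -/

section Head

variable {L : Type} [Field L] [NumberField L] (w : HeightOneSpectrum (𝓞 L)) [Algebra ℚ_[p] (w.adicCompletion L)]

/-- **B7 HEAD — THE PLANTED PLACE `v′` AND `α ∉ 𝔭_u` FOR EVERY `u ≠ v′`.**  At `K = L_w` (`p ∈ 𝔭_w`, continuous finite `ℚ_p`-structure) let `F` be a number
field with `α ∈ 𝓞 F`, `[F : ℚ] = [K : ℚ_p] + r`, `|N_{F∕ℚ}(α)| = p^a`; let `J₀ : F →+* K` with `J₀ α = β`, `ℚ_p⟮β⟯ = ⊤`, `v_w(β) < 1`, and `J i : F →+* ℚ_p` (`i < r`)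
with `J i α = c′ᵢ`, the `c′ᵢ ∈ ℤ_p^×` distinct units (★ B6's outputs, through the captain's lift).  THEN `J₀` has dense image and pins a place `v′` of `F`
(`x ∈ 𝔭_{v′} ⟺ v_w(J₀ x) < 1`) containing `p` and `α`, and `α ∉ 𝔭_u` for EVERY finite place `u ≠ v′` of `F` — the `hαu` input of ★ P8c (for all `u`,
odd or dyadic).  Proof: §-docstring above (★ P1, P2″, P5, P9′, `CompletionLocalDegree`, Mathlib `Ideal.sum_ramification_inertia`, `Algebra.finrank_eq_of_equiv_equiv`).
[cite: NeukirchANT1999, Ch. II (8.2)-(8.5)] [cite: CasselsFrohlichANT1967, Ch. II §10 (10.2)-(10.3)] [cite: Serre1979, Ch. II §3] -/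
theorem exists_plantedPlace (hw : ((p : ℕ) : 𝓞 L) ∈ w.asIdeal) (hc : Continuous (algebraMap ℚ_[p] (w.adicCompletion L)))
    {F : Type} [Field F] [NumberField F] (α : 𝓞 F) {r : ℕ} (hd : Module.finrank ℚ F = Module.finrank ℚ_[p] (w.adicCompletion L) + r)
    {a : ℕ} (hN : |Algebra.norm ℚ (α : F)| = (p ^ a : ℕ))
    (J₀ : F →+* w.adicCompletion L) {β : w.adicCompletion L} (hJ₀α : J₀ (α : F) = β) (hβ : ℚ_[p]⟮β⟯ = ⊤) (hβ1 : Valued.v β < 1)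
    (c' : Fin r → ℤ_[p]) (hcu : ∀ i, IsUnit (c' i)) (hci : Function.Injective c')
    (J : Fin r → (F →+* ℚ_[p])) (hJα : ∀ i, J i (α : F) = ((c' i : ℤ_[p]) : ℚ_[p])) :
    DenseRange J₀ ∧ ∃ v' : HeightOneSpectrum (𝓞 F), (∀ x : 𝓞 F, x ∈ v'.asIdeal ↔ Valued.v (J₀ (x : F)) < 1) ∧
      ((p : ℕ) : 𝓞 F) ∈ v'.asIdeal ∧ α ∈ v'.asIdeal ∧ ∀ u : HeightOneSpectrum (𝓞 F), u ≠ v' → α ∉ u.asIdeal := by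
  classical
  -- density of `J₀` (★ P2″ §3) and the pinned place `v′` (★ P1)
  have hJ₀d : DenseRange J₀ := denseRange_of_adjoin_eq_top p hc hβ J₀ ⟨α, hJ₀α⟩
  obtain ⟨v', hv'pin, ψ, hψc, hψc', hψJ⟩ := exists_adicCompletion_ringEquiv_of_denseRange w J₀ hJ₀d
  have hαv' : α ∈ v'.asIdeal := (hv'pin α).2 (by rw [hJ₀α]; exact hβ1)
  have hpv' : ((p : ℕ) : 𝓞 F) ∈ v'.asIdeal := (hv'pin _).2 (by
    rw [RingOfIntegers.coe_eq_algebraMap, map_natCast, map_natCast]; exact valued_natCast_lt_one_of_mem p w hw)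
  refine ⟨hJ₀d, v', hv'pin, hpv', hαv', ?_⟩
  -- LOCAL DEGREE of `v′`: `e′f′(v′) = [K : ℚ_p]` through the `ℚ_p`-structure transported along `ψ`
  have hdeg_v' : Ideal.ramificationIdx' (Ideal.span {(p : ℤ)}) v'.asIdeal * Ideal.inertiaDeg' (Ideal.span {(p : ℤ)}) v'.asIdeal =
      Module.finrank ℚ_[p] (w.adicCompletion L) := by
    letI alg : Algebra ℚ_[p] (v'.adicCompletion F) := (ψ.symm.toRingHom.comp (algebraMap ℚ_[p] (w.adicCompletion L))).toAlgebra
    have hc' : Continuous (algebraMap ℚ_[p] (v'.adicCompletion F)) := hψc'.comp hc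
    rw [← finrank_padic_adicCompletion_eq' p v' hpv' hc']
    refine Algebra.finrank_eq_of_equiv_equiv (RingEquiv.refl ℚ_[p]) ψ (RingHom.ext fun x => ?_)
    change algebraMap ℚ_[p] (w.adicCompletion L) x = ψ (ψ.symm (algebraMap ℚ_[p] (w.adicCompletion L) x))
    rw [ψ.apply_symm_apply]
  -- the `(p)`-adic place `v₀` of `ℚ` and `E : ℚ_p ≃ ℚ_{v₀}`
  set v₀ : HeightOneSpectrum (𝓞 ℚ) := (Rat.HeightOneSpectrum.primesEquiv (R := 𝓞 ℚ)).symm ⟨p, Fact.out⟩ with hv₀def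
  have hv₀ : ((p : ℕ) : 𝓞 ℚ) ∈ v₀.asIdeal := natCast_mem_primesEquiv_symm p
  -- (pin the `ℚ`-algebra structure of `ℚ_{v₀}` to the one in the type of Mathlib's `Padic.adicCompletionEquiv`; all `ℚ`-algebra structures agree)
  letI instQv₀ : Algebra ℚ (v₀.adicCompletion ℚ) := HeightOneSpectrum.instAlgebraAdicCompletion (𝓞 ℚ) ℚ v₀
  let E₀ := Padic.adicCompletionEquiv (𝓞 ℚ) ⟨p, Fact.out⟩
  let E : ℚ_[p] ≃+* v₀.adicCompletion ℚ := E₀.toRingEquiv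
  have hEc : Continuous E := E₀.continuous
  have hEc' : Continuous E.symm := E₀.symm.continuous
  -- the embeddings `J′ i : F → ℚ_{v₀}`: dense, pinning places `U i ∣ p` with `α ∉ 𝔭_{U i}` and local degree `1`
  let J' : Fin r → (F →+* v₀.adicCompletion ℚ) := fun i => E.toRingHom.comp (J i)
  have hJ'apply : ∀ i (x : F), J' i x = E (J i x) := fun i x => rfl
  have hJ'd : ∀ i, DenseRange (J' i) := fun i => by
    refine Dense.mono ?_ (HeightOneSpectrum.denseRange_algebraMap ℚ v₀)
    rintro _ ⟨q, rfl⟩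
    refine ⟨(q : F), ?_⟩
    rw [hJ'apply, map_ratCast, map_ratCast]
    exact (eq_ratCast _ q).symm
  have hU : ∀ i, ∃ U : HeightOneSpectrum (𝓞 F), (∀ x : 𝓞 F, x ∈ U.asIdeal ↔ Valued.v (J' i (x : F)) < 1) ∧
      ((p : ℕ) : 𝓞 F) ∈ U.asIdeal ∧ α ∉ U.asIdeal ∧
      Ideal.ramificationIdx' (Ideal.span {(p : ℤ)}) U.asIdeal * Ideal.inertiaDeg' (Ideal.span {(p : ℤ)}) U.asIdeal = 1 := fun i => by
    obtain ⟨U, hUpin, ψU, hψUc, hψUc', -⟩ := exists_adicCompletion_ringEquiv_of_denseRange v₀ (J' i) (hJ'd i)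
    have hpU : ((p : ℕ) : 𝓞 F) ∈ U.asIdeal := (hUpin _).2 (by
      rw [RingOfIntegers.coe_eq_algebraMap, map_natCast, map_natCast]; exact valued_natCast_lt_one_of_mem p v₀ hv₀)
    refine ⟨U, hUpin, hpU, fun hαU => ?_, ?_⟩
    · -- `α ∉ 𝔭_U`: `v(E c′ᵢ) < 1 ⟺ ‖c′ᵢ‖ < 1`, false for a unit
      have h1 := (hUpin α).1 hαU
      rw [hJ'apply, hJα, valued_ringEquiv_lt_one_iff p v₀ E hEc hEc', PadicInt.padic_norm_e_of_padicInt, PadicInt.isUnit_iff.1 (hcu i)] at h1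
      exact lt_irrefl _ h1
    · -- local degree `1`: the `ℚ_p`-structure `ℚ_p ≃ ℚ_{v₀} ≃ F_U`
      letI alg : Algebra ℚ_[p] (U.adicCompletion F) := (ψU.symm.toRingHom.comp E.toRingHom).toAlgebra
      have hcU : Continuous (algebraMap ℚ_[p] (U.adicCompletion F)) := hψUc'.comp hEc
      rw [finrank_padic_adicCompletion_eq' p U hpU hcU |>.symm, ← Module.finrank_self ℚ_[p]]
      symm
      refine Algebra.finrank_eq_of_equiv_equiv (RingEquiv.refl ℚ_[p]) (E.trans ψU.symm) (RingHom.ext fun x => ?_)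
      change ψU.symm (E x) = ψU.symm (E (algebraMap ℚ_[p] ℚ_[p] x))
      rw [Algebra.algebraMap_self, RingHom.id_apply]
  choose U hUpin hpU hαU hdegU using hU
  -- the `U i` are pairwise distinct (★ P9′) and distinct from `v′`
  have hUinj : Function.Injective U := by
    intro i j hij
    by_contra hne
    have hne' : J' i (α : F) ≠ J' j (α : F) := by
      rw [hJ'apply, hJ'apply, hJα, hJα]
      intro h
      exact hne (hci (PadicInt.ext (E.injective h)))
    obtain ⟨x, hx⟩ := exists_valued_apply_ne_of_apply_ne_rat F v₀ (J' i) (J' j) (α : F) hne'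
    exact ne_of_valued_apply_ne F v₀ v₀ (J' i) (J' j) (hJ'd i) (hJ'd j) (hUpin i) (hUpin j) x hx hij
  have hv'U : ∀ i, v' ≠ U i := fun i h => hαU i (h ▸ hαv')
  -- EXHAUSTION: `T := {v′} ∪ {U i}` carries `Σ e′f′ = d₀ + r = [F : ℚ]`
  set T : Finset (HeightOneSpectrum (𝓞 F)) := insert v' (Finset.univ.image U) with hT
  have hTp : ∀ u ∈ T, ((p : ℕ) : 𝓞 F) ∈ u.asIdeal := by
    intro u hu
    rcases Finset.mem_insert.1 hu with rfl | hu
    · exact hpv'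
    · obtain ⟨i, -, rfl⟩ := Finset.mem_image.1 hu
      exact hpU i
  have hv'nmem : v' ∉ Finset.univ.image U := by
    intro h
    obtain ⟨i, -, hi⟩ := Finset.mem_image.1 h
    exact hv'U i hi.symm
  have hsum : ∑ u ∈ T, Ideal.ramificationIdx' (Ideal.span {(p : ℤ)}) u.asIdeal * Ideal.inertiaDeg' (Ideal.span {(p : ℤ)}) u.asIdeal = Module.finrank ℚ F := by
    rw [hT, Finset.sum_insert hv'nmem, Finset.sum_image fun i _ j _ h => hUinj h, hdeg_v', hd]
    simp only [hdegU, Finset.sum_const, Finset.card_univ, Fintype.card_fin, smul_eq_mul, mul_one]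
  -- the unit clause
  intro u hu
  by_cases hpu : ((p : ℕ) : 𝓞 F) ∈ u.asIdeal
  · -- `u ∣ p`: `u ∈ T`, `u ≠ v′` ⇒ `u = U i`
    have huT := forall_mem_of_sum_ramificationIdx_mul_inertiaDeg_eq_finrank_int p T hTp hsum u hpu
    rcases Finset.mem_insert.1 huT with h | h
    · exact absurd h hu
    · obtain ⟨i, -, rfl⟩ := Finset.mem_image.1 h
      exact hαU i
  · -- `u ∤ p`: ★ P5
    exact not_mem_of_absNorm_eq_prime_pow_of_natCast_not_mem (Fact.out : p.Prime) (absNorm_span_singleton_eq_of_abs_norm_eq α hN) u hpu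

end Head

end Summit.HodgeConjecture.HodgeConjecture.R90.S3

end
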